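import Summits.KontsevichZagierPeriods.KontsevichZagierPeriods.Theses.IsogenyCertificates
import Literature.NumberTheory.Transcendental.KZKernelConjectureForms
import Literature.NumberTheory.Transcendental.KZSubcalculusInvariants
import Literature.NumberTheory.Transcendental.KZRulesAssociator
import Summits.KontsevichZagierPeriods.KontsevichZagierPeriods.Theorems.XMapPeriodTransfer.Negative.LemniscateReps
import Literature.ModelTheory.ExponentialFields.OMinimalEulerInvariance

/-!
# Disproof of `XMapKernel` (crux stmt-KontsevichZagierPeriods-10663) — findings

Standing-adversary work file (cdisprove seat, route IsogenyCertificates, rank-0 crux = the route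
TARGET, auto-promoted to crux because its docstring avows "conjecture"). Prose only in docstrings;
every `theorem` below is checked (`lean check` rc 0), no `sorry` (cycle 2: the former near-miss F8 is
proved in the Negative-lane files, see §6).

**VERDICT (cycle 1): NO KILL, and no cheap kill exists.** `not_summit_of_not` (§1): the summit statement
`KontsevichZagierPeriods` IMPLIES the crux outright (kernel form of Conjecture 1, proved equivalent to
the summit in `KZKernelConjectureForms.lean`, then monotonicity of `AddSubgroup.closure` in the
generating set). Hence `not_summit_of_not`: a Lean refutation `¬ XMapKernel` is *literally* a
refutation of the formalised Kontsevich–Zagier period conjecture — route Neg's whole programme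
(Gauss triplication 0311, CancellationGap), not a statement-level defect of this route. Conversely
(`iff_summit_of_transfer`) modulo the sibling crux `XMapPeriodTransfer` the crux IS the summit, and
the route thesis `XMapPeriodTransfer ∧ XMapKernel` is an exact reformulation of the summit
(`thesis_iff_summit`). The shape of any kill is `not_iff` / `not_of_separating_invariant`: an additive
invariant of `FormalRep` killing the four move sets AND the x-map relators but not `ker eval` — none
is known in print or in the tree (HuberWustholz2022 Thm 13.3, p. 121, PROVES the period conjecture for
1-periods in the Nori/cohomological formulation and, Remarks 13.2(2), defers the comparison with
Kontsevich's original rules formulation to HuberMullerStach2017 Rem. 13.1.8 — neither bears on the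
rules calculus of all dimensions quantified over here).

## Findings (index)
* **F1 strength** (§1): `not_kzKernelConjecture_of_not`, `summit_iff_kzKernelConjecture`,
  `not_summit_of_not` (summit ⇒ crux, contrapositively), `xMapRel_subset_relations_iff_transfer`,
  `iff_kzKernelConjecture_of_transfer`, `iff_summit_of_transfer`, `not_summit_of_not_transfer`,
  `thesis_iff_summit` (positive directions are stated as `↔`/contrapositives on purpose: no theorem here
  has a route decl as its literal conclusion).
* **F2 soundness of the enlarged calculus** (§0): `xMapRel_subset_ker_eval`, `closure_gens_le_ker_eval`,
  `xMapKernel_iff_closure_eq_ker` — the crux says `closure gens = ker eval` (only `≥` is open).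
* **F3 shape of a kill** (§2): `not_iff`, `not_of_separating_invariant`,
  `exists_separating_invariant_of_not` (the template is complete: the quotient map works).
* **F4 load-bearing hypotheses** (§3): `false_without_eval` (the hypothesis `eval c = 0` is
  essential: `[pt, 1]` is an honest generator of value `1`, so `closure gens ≠ ⊤`);
  `false_without_newtonLeibniz` (**any proof must use rule 3**: the dimension-0 evaluation
  `dimZeroEval` kills moves (1a), (1b), (2) and every x-map relator — they never change dimension —
  but not the honest kernel element `[pt,1]·[0,1] − [pt,1]`); `false_without_additivity` (**any proof
  must use an additivity move**: `KZ.coeffSum` kills (2), (3) and the x-map relators, but the empty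
  representation `[∅]` has value `0` and coefficient sum `1`). Dropping the x-map relators gives
  `KZKernelConjecture` verbatim (`withoutXMapRel_iff`) — open, summit-equivalent. Dropping (1a) alone:
  paper proof (F8, §6); (2) alone or (1b) alone: status unknown, no additive invariant found (§6).
* **F5 refuted natural strengthenings** (§4): `not_ker_le_closure_of_subset` (no generating subset
  avoiding rule 3, or avoiding both additivity rules, generates `ker eval`; in particular the x-map
  relators alone do not: `not_ker_le_closure_xMapRel`), `closure_gens_ne_top`.
* **F6 non-vacuity of the relator set** (§5 + `Theorems/XMapKernel/Negative/LandenRelator.lean`, p98170 ACCEPTED): `0 ∈ xMapRel` (identity datum on `y² = x³+4x`,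
  §5 here) and a NON-ZERO relator exists — the Landen/Gauss pair
  `[{x³−x>0}, 1/√(x³−x)] − [{X³+4X>0}, 2/√(X³+4X)]` with the 2-isogeny datum `(X²−1, X, 1)`: its
  VALUE EQUALITY is PROVED (`value_lemniscate_eq_value_four`: both `= 2ϖ = Γ(1/4)²/√(2π)`, by the
  substitution `X = x − 1/x` on `(1,∞)`, `X³+4X = (x³−x)((x²+1)/x²)²`, plus the tree's lemniscatic
  integral and the sibling's reflection/inversion for the sheet `(−1,0)`); the relator has
  `restrictedEval` over `{x<0}` equal to `ϖ ≠ 0`, hence lies outside the additive sub-calculus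
  `closure((1a) ∪ (1b))` and is `≠ 0`, while `coeffSum = 0` (`exists_landen_relator`). This also
  discharges the value side of support item LemniscateTwoIsogeny (5382) / the calibration pair of
  XMapPeriodTransfer (10665) for the provers.
* **F7 rule 3 is needed at EVERY level** (`Theorems/XMapKernel/Negative/LevelwiseNewtonLeibniz.lean`,
  p98622 ACCEPTED): for each `N`, the truncated evaluation
  `truncEval N` (evaluate generators of dimension `≤ N` only) kills (1a), (1b), (2), the x-map relators
  and every Newton–Leibniz instance of level `n ≠ N`, but not the unit slab tower
  `[pt,1]·[0,1]^{N+1} − [pt,1]·[0,1]^N`; so `false_without_newtonLeibniz_level N`: the crux with rule 3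
  confined to levels `≠ N` is false. No bounded (or co-bounded) range of dimensions suffices.
* **F8 (§6) rule (1a) is load-bearing — PROVED modulo the tree fact vdD Ch. 4 (2.4)** (cycle 2;
  folder `EulerWeightedEval.lean` p100323, `DomainAdditivity.lean`, `CubicRealLocus.lean` p99637 ACCEPTED,
  `CubicLocusEuler.lean`; chain `PartBCheck2.lean` rc 0, attached): the Euler-weighted evaluation
  `𝟙[E(σ)=0]·∫_σ f` kills (1b), (2), (3) AND every x-map relator (cubic loci have `E ∈ {−1,−2}` by the
  real root structure) but is `−1` on the (1a) instance `[(0,2)] − [(0,1]] − [(1,2)]`; hence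
  `hE → ¬ WithoutDomainAdd`. Unconditionally (1b)+(3) do not generate `ker eval`.
  (1b) alone and (2) alone remain OPEN (`WithoutIntegrandAdd`, `WithoutChangeOfVariables`, §6).
* Targets: none yet (payload.targets = ∅, no line picked). Near-misses: none (F8 closed in cycle 2).

* **LANDED**: `Summits.KontsevichZagierPeriods.KontsevichZagierPeriods.Theorems.XMapKernel.Negative.Core`
  (p76477 ACCEPTED, commit 20f7659c9122: §§0–4 of this file under namespace
  `Summit.KontsevichZagierPeriods.XMapKernel.Negative` — `crux_iff`, `closure_gens_le_ker_eval`,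
  `crux_iff_closure_eq_ker`, `not_summit_of_not`, `iff_summit_of_transfer`, `thesis_iff_summit`,
  `not_iff`, `not_of_separating_invariant`, `exists_separating_invariant_of_not`, `false_without_eval`,
  `false_without_newtonLeibniz`, `false_without_additivity`, `withoutXMapRel_iff`, …); importable by
  ideators / planners / provers. ALSO LANDED: `Negative/LandenRelator.lean` (F6, p98170 ACCEPTED, db6b0749abc7),
  `Negative/LevelwiseNewtonLeibniz.lean` (F7, p98622 ACCEPTED, eeba7a06571e), `Negative/CubicRealLocus.lean`
  (F8, p99637 ACCEPTED, 2d455b9631ad); pending `Negative/EulerWeightedEval.lean` (p100323) → then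
  `DomainAdditivity.lean`, `CubicLocusEuler.lean`. Note (found at review): the four-move-calculus case of F8
  (rule (1a) essential for Conjecture 1, parity weight) was landed independently by the CompleteModGammaSector
  disprover (`CompleteModGammaSectorNegative.not_periodConjecture_rulesNoDomainAdd`); the x-map sector needs
  the weight `𝟙_{0}` instead (cubic loci have `E ∈ {−1,−2}` of both parities).

## Attack log (why it resists)
* small / finite models: none exist — the statement quantifies over honest Lebesgue integrals of
  semialgebraic functions; nothing is decidable.
* degenerate instances: `c = 0` (trivially in the closure); duplicate generators `[σ,f] − [σ,f′]`
  with `f = f′` on `σ` (one rule-2 move with `Φ = id`, or one rule-1a move); null domains and `[∅]`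
  (relations by rule 1a with `σ = σ ∪ σ`); dimension `0` (all `ℤ`-relations among real algebraic
  constants are rule-1b moves) — every degenerate kernel element tried is derivable.
* junk in the x-map datum: irrelevant HERE — every element of the relator set has `eval = 0` by its
  value-equality conjunct (`xMapRel_subset_ker_eval`), so junk data could only make the crux WEAKER;
  the datum's non-degeneracy (`g ≠ 0`, `c ≠ 0` forced) is the sibling disprover's finding
  (Cruxes/XMapPeriodTransfer/Disproof.lean §1, cited, not re-proved).
* barrier catalogue (`Literature/Barriers/KontsevichZagierPeriods/`): the three
  `GrothendieckPeriodConjectureDependence*` entries say exactly F1 (kernel-type statements carry GPC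
  strength); `PeriodEqualityDecidability` (summit ⇒ equality of periods is Σ⁰₁-decidable relative to
  the side conditions) is consistent, not a refutation; `AlgebraicPrimitivesObstruction`,
  `HauptvermutungObstruction` concern proof TECHNIQUES for transfer statements, not kernel statements.
* negatives index (`ledger negatives`): 1 entry (KinematicFormulas convexity, dimension-2 scissors),
  unrelated.
-/

noncomputable section

-- The crux-workfile namespace `Summit.<P>.<Sub>.Cruxes.<Crux>.Disproof` is prescribed by the cdisprove protocol and
-- repeats the summit name (single-conjunct summit: Sub = Summit); silence only that linter.
set_option linter.dupNamespace false

namespace Summit.KontsevichZagierPeriods.KontsevichZagierPeriods.Cruxes.XMapKernel.Disproof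

open Literature.NumberTheory.Transcendental
open Summit.KontsevichZagierPeriods.KontsevichZagierPeriods.Theses.IsogenyCertificates
open Set MeasureTheory

/-! ## §0 Vocabulary and soundness of the enlarged calculus -/

/-- The x-map period relators, literally the fifth generating set of the crux:
`[r] − [r′]` for `r = [{P>0}, a/√P]`, `r′ = [{P′>0}, b/√P′]` joined by an x-rational isogeny datum
`(f, g, c)` and with EQUAL VALUES. -/
def xMapRel : Set KZ.FormalRep :=
  {d | ∃ (A B A' B' : ℤ) (f g : Polynomial ℚ) (c a b : ℚ) (r r' : KZ.IntegralRep 1),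
    4 * A ^ 3 + 27 * B ^ 2 ≠ 0 ∧ 4 * A' ^ 3 + 27 * B' ^ 2 ≠ 0 ∧
    Polynomial.derivative f * g - f * Polynomial.derivative g ≠ 0 ∧
    Polynomial.C (c ^ 2) * g * (f ^ 3 + Polynomial.C (A' : ℚ) * f * g ^ 2 + Polynomial.C (B' : ℚ) * g ^ 3) =
      (Polynomial.X ^ 3 + Polynomial.C (A : ℚ) * Polynomial.X + Polynomial.C (B : ℚ)) *
        (Polynomial.derivative f * g - f * Polynomial.derivative g) ^ 2 ∧
    0 < a ∧ 0 < b ∧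
    r.domain = {x | 0 < x 0 ^ 3 + (A : ℝ) * x 0 + (B : ℝ)} ∧
    Set.EqOn r.integrand (fun x => (a : ℝ) / Real.sqrt (x 0 ^ 3 + (A : ℝ) * x 0 + (B : ℝ))) r.domain ∧
    r'.domain = {x | 0 < x 0 ^ 3 + (A' : ℝ) * x 0 + (B' : ℝ)} ∧
    Set.EqOn r'.integrand (fun x => (b : ℝ) / Real.sqrt (x 0 ^ 3 + (A' : ℝ) * x 0 + (B' : ℝ))) r'.domain ∧
    r.value = r'.value ∧ d = KZ.of r - KZ.of r'}

/-- The four move sets of the KZ calculus (their closure is `KZ.relations` by definition). -/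
def moves : Set KZ.FormalRep :=
  KZ.domainAddRel ∪ KZ.integrandAddRel ∪ KZ.changeOfVariablesRel ∪ KZ.newtonLeibnizRel

/-- The crux's generating set: the four moves and the x-map relators. -/
def gens : Set KZ.FormalRep := moves ∪ xMapRel

/-- `KZ.relations = closure moves` (definitional). -/
theorem relations_eq_closure_moves : KZ.relations = AddSubgroup.closure moves := rfl

/-- The crux, unfolded: `ker eval ⊆ closure gens`. -/
theorem xMapKernel_iff :
    XMapKernel ↔ ∀ c : KZ.FormalRep, KZ.eval c = 0 → c ∈ AddSubgroup.closure gens := Iff.rfl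

/-- The same with `AddSubgroup`s: `ker eval ≤ closure gens`. -/
theorem xMapKernel_iff_ker_le : XMapKernel ↔ KZ.eval.ker ≤ AddSubgroup.closure gens := by
  rw [xMapKernel_iff]
  constructor
  · intro h c hc
    exact h c (by simpa using hc)
  · intro h c hc
    exact h (by simpa using hc)

/-- Every x-map relator evaluates to `0` (its value-equality conjunct). No datum analysis is needed:
junk data, if any, could only ENLARGE the relator set inside `ker eval`. -/
theorem xMapRel_subset_ker_eval : xMapRel ⊆ (KZ.eval.ker : Set KZ.FormalRep) := by
  rintro d ⟨A, B, A', B', f, g, c, a, b, r, r', -, -, -, -, -, -, -, -, -, -, hv, rfl⟩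
  simp [KZ.eval_of_sub_of, hv]

/-- `relations ≤ closure gens` (monotonicity of the closure). -/
theorem relations_le_closure_gens : KZ.relations ≤ AddSubgroup.closure gens :=
  AddSubgroup.closure_mono subset_union_left

/-- **Soundness of the enlarged calculus**: `closure gens ≤ ker eval`. -/
theorem closure_gens_le_ker_eval : AddSubgroup.closure gens ≤ KZ.eval.ker := by
  rw [AddSubgroup.closure_le]
  rintro d (hd | hd)
  · exact KZ.relations_le_ker_eval_holds (AddSubgroup.subset_closure hd)
  · exact xMapRel_subset_ker_eval hd

/-- The crux says exactly `closure gens = ker eval`; the inclusion `≤` is the theorem above. -/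
theorem xMapKernel_iff_closure_eq_ker : XMapKernel ↔ AddSubgroup.closure gens = KZ.eval.ker := by
  rw [xMapKernel_iff_ker_le]
  exact ⟨fun h => le_antisymm closure_gens_le_ker_eval h, fun h => h.ge⟩

/-! ## §1 Strength: the crux is a corollary of the summit, and modulo transfer it IS the summit -/

/-- **Kernel conjecture ⇒ crux** (monotonicity of the closure in the generating set), stated
contrapositively so that no theorem of this file has a route decl as its literal conclusion. -/
theorem not_kzKernelConjecture_of_not (h : ¬ XMapKernel) : ¬ KZKernelConjecture := fun hK =>
  h fun c hc => relations_le_closure_gens (hK c hc)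

/-- The summit statement is the kernel conjecture (tree: `kzKernelConjecture_iff_isRational`). -/
theorem summit_iff_kzKernelConjecture : KontsevichZagierPeriods ↔ KZKernelConjecture :=
  KontsevichZagierPeriods_iff.trans kzKernelConjecture_iff_isRational.symm

/-- **F1. The summit implies the crux** (contrapositive form): a kill of this crux kills the
formalised period conjecture. So no refutation of `XMapKernel` is cheaper than a refutation of the
summit itself. -/
theorem not_summit_of_not (h : ¬ XMapKernel) : ¬ KontsevichZagierPeriods := fun hs =>
  not_kzKernelConjecture_of_not h (summit_iff_kzKernelConjecture.1 hs)

/-- The sibling crux `XMapPeriodTransfer` says exactly that the x-map relators are relations. -/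
theorem xMapRel_subset_relations_iff_transfer :
    xMapRel ⊆ (KZ.relations : Set KZ.FormalRep) ↔ XMapPeriodTransfer := by
  constructor
  · intro h A B A' B' hΔ hΔ' f g c hW hI a b ha hb r r' h1 h2 h3 h4 h5
    exact h ⟨A, B, A', B', f, g, c, a, b, r, r', hΔ, hΔ', hW, hI, ha, hb, h1, h2, h3, h4, h5, rfl⟩
  · rintro hT d ⟨A, B, A', B', f, g, c, a, b, r, r', hΔ, hΔ', hW, hI, ha, hb, h1, h2, h3, h4, h5, rfl⟩
    exact hT A B A' B' hΔ hΔ' f g c hW hI a b ha hb r r' h1 h2 h3 h4 h5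

/-- If the x-map relators are relations, `closure gens = relations`. -/
theorem closure_gens_eq_relations (hX : xMapRel ⊆ (KZ.relations : Set KZ.FormalRep)) :
    AddSubgroup.closure gens = KZ.relations := by
  refine le_antisymm ?_ relations_le_closure_gens
  rw [AddSubgroup.closure_le]
  rintro d (hd | hd)
  · exact AddSubgroup.subset_closure hd
  · exact hX hd

/-- Modulo transfer the crux is the kernel conjecture … -/
theorem iff_kzKernelConjecture_of_transfer (hT : XMapPeriodTransfer) : XMapKernel ↔ KZKernelConjecture := by
  refine ⟨fun h c hc => ?_, fun hK => by_contra fun h => not_kzKernelConjecture_of_not h hK⟩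
  rw [← closure_gens_eq_relations (xMapRel_subset_relations_iff_transfer.2 hT)]
  exact h c hc

/-- … i.e. the summit. -/
theorem iff_summit_of_transfer (hT : XMapPeriodTransfer) : XMapKernel ↔ KontsevichZagierPeriods :=
  (iff_kzKernelConjecture_of_transfer hT).trans summit_iff_kzKernelConjecture.symm

/-- The summit implies the transfer crux too (two-representation form with algebraic endpoints,
`KZPeriodConjecture'`, is equivalent to the kernel form in tree); contrapositive form. -/
theorem not_summit_of_not_transfer (h : ¬ XMapPeriodTransfer) : ¬ KontsevichZagierPeriods := fun hs => by
  have h' : KZPeriodConjecture' :=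
    KZKernelConjecture.kzPeriodConjecture' (summit_iff_kzKernelConjecture.1 hs)
  exact h fun A B A' B' _ _ f g c _ _ a b _ _ r r' _ _ _ _ hv => h' r r' hv

/-- **The route thesis is an exact reformulation of the summit**: `XMapPeriodTransfer ∧ XMapKernel ↔
KontsevichZagierPeriods` (`→` is the planner's `closes`; `←` is F1 + `not_summit_of_not_transfer`). -/
-- buildfix 2026-08-20 (ops-buildfix lane, proof-only): the route's `closes` was re-cut to 5 binders
-- (IsogenyCertificates rev 15); the `→` direction is this file's own `iff_summit_of_transfer`.
theorem thesis_iff_summit : (XMapPeriodTransfer ∧ XMapKernel) ↔ KontsevichZagierPeriods :=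
  ⟨fun h => (iff_summit_of_transfer h.1).1 h.2, fun h =>
    ⟨by_contra fun hT => not_summit_of_not_transfer hT h, by_contra fun hK => not_summit_of_not hK h⟩⟩

/-! ## §2 The shape of any kill -/

/-- `¬ crux` unfolded: an element of `ker eval` outside `closure gens`. -/
theorem not_iff : ¬ XMapKernel ↔ ∃ c : KZ.FormalRep, KZ.eval c = 0 ∧ c ∉ AddSubgroup.closure gens := by
  rw [xMapKernel_iff]
  push Not
  rfl

/-- **Separating-invariant template.** An additive invariant killing every generator (the four move
sets AND the x-map relators) but not some kernel element refutes the crux. -/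
theorem not_of_separating_invariant {G : Type*} [AddCommGroup G] (ψ : KZ.FormalRep →+ G)
    (hψ : gens ⊆ (ψ.ker : Set KZ.FormalRep)) {c : KZ.FormalRep} (hc : KZ.eval c = 0) (hψc : ψ c ≠ 0) :
    ¬ XMapKernel := fun h =>
  hψc ((AddSubgroup.closure_le _).2 hψ (h c hc))

/-- The template is complete: from any counterexample the quotient map is a separating invariant. -/
theorem exists_separating_invariant_of_not (h : ¬ XMapKernel) :
    ∃ (ψ : KZ.FormalRep →+ KZ.FormalRep ⧸ AddSubgroup.closure gens) (c : KZ.FormalRep),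
      gens ⊆ (ψ.ker : Set KZ.FormalRep) ∧ KZ.eval c = 0 ∧ ψ c ≠ 0 := by
  obtain ⟨c, hc, hcn⟩ := not_iff.1 h
  refine ⟨QuotientAddGroup.mk' _, c, fun d hd => ?_, hc, ?_⟩
  · rw [SetLike.mem_coe, QuotientAddGroup.ker_mk']
    exact AddSubgroup.subset_closure hd
  · rwa [Ne, QuotientAddGroup.mk'_apply, QuotientAddGroup.eq_zero_iff]

/-! ## §3 Load-bearing analysis

Three hypotheses/ingredients are shown essential by explicit additive invariants; the remaining
single-move drops are recorded as open (no invariant is known that kills (1a), (1b), (3) and is not a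
multiple of `eval` — cf. Cruxes/RealEllipticSectorKernel/Disproof.lean, cycle-2 attack log). -/

/-- The crux with its only hypothesis `eval c = 0` dropped: `closure gens = ⊤`. -/
def WithoutEval : Prop := ∀ c : KZ.FormalRep, c ∈ AddSubgroup.closure gens

/-- **`eval c = 0` is load-bearing**: the honest generator `[pt, 1]` (`KZ.IntegralRep.unit`, value
`1`) is not in `closure gens ≤ ker eval`. -/
theorem false_without_eval : ¬ WithoutEval := fun h => by
  have h1 := closure_gens_le_ker_eval (h (KZ.of KZ.IntegralRep.unit))
  rw [AddMonoidHom.mem_ker, KZ.eval_of, KZ.IntegralRep.value_unit] at h1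
  exact one_ne_zero h1

/-- Equivalently: the enlarged move group is a proper subgroup. -/
theorem closure_gens_ne_top : AddSubgroup.closure gens ≠ ⊤ := fun h =>
  false_without_eval fun c => h ▸ AddSubgroup.mem_top c

/-- Generators without rule (3): moves (1a), (1b), (2) and the x-map relators. -/
def gensWithoutNL : Set KZ.FormalRep :=
  KZ.domainAddRel ∪ KZ.integrandAddRel ∪ KZ.changeOfVariablesRel ∪ xMapRel

/-- The crux with the Newton–Leibniz move dropped from the generating set. -/
def WithoutNewtonLeibniz : Prop :=
  ∀ c : KZ.FormalRep, KZ.eval c = 0 → c ∈ AddSubgroup.closure gensWithoutNL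

/-- Projection of a formal combination onto its dimension-`0` generators. -/
def dimZeroPart : KZ.FormalRep →+ KZ.FormalRep :=
  FreeAbelianGroup.lift fun p => if p.1 = 0 then FreeAbelianGroup.of p else 0

@[simp] theorem dimZeroPart_of {n : ℕ} (r : KZ.IntegralRep n) :
    dimZeroPart (KZ.of r) = if n = 0 then KZ.of r else 0 := by
  simp [dimZeroPart, KZ.of]

/-- **The dimension-`0` evaluation**: evaluate only the `0`-dimensional generators (the constants). -/
def dimZeroEval : KZ.FormalRep →+ ℝ := KZ.eval.comp dimZeroPart

@[simp] theorem dimZeroEval_of {n : ℕ} (r : KZ.IntegralRep n) :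
    dimZeroEval (KZ.of r) = if n = 0 then r.value else 0 := by
  simp only [dimZeroEval, AddMonoidHom.coe_comp, Function.comp_apply, dimZeroPart_of]
  split_ifs <;> simp

/-- On a combination supported in one dimension `n`, `dimZeroEval` is `eval` if `n = 0` and `0`
otherwise; the three dimension-preserving moves are sound, so they die. -/
theorem dimZeroEval_eq_zero_of_mem_domainAddRel {c : KZ.FormalRep} (hc : c ∈ KZ.domainAddRel) :
    dimZeroEval c = 0 := by
  have h0 : KZ.eval c = 0 := KZ.eval_eq_zero_of_mem_domainAddRel_holds hc
  obtain ⟨n, r, r₁, r₂, -, -, -, -, rfl⟩ := hc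
  by_cases hn : n = 0
  · subst hn
    simpa [map_sub] using h0
  · simp [map_sub, hn]

theorem dimZeroEval_eq_zero_of_mem_integrandAddRel {c : KZ.FormalRep} (hc : c ∈ KZ.integrandAddRel) :
    dimZeroEval c = 0 := by
  have h0 : KZ.eval c = 0 := KZ.eval_eq_zero_of_mem_integrandAddRel_holds hc
  obtain ⟨n, r, r₁, r₂, -, -, -, rfl⟩ := hc
  by_cases hn : n = 0
  · subst hn
    simpa [map_sub] using h0
  · simp [map_sub, hn]

theorem dimZeroEval_eq_zero_of_mem_changeOfVariablesRel {c : KZ.FormalRep}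
    (hc : c ∈ KZ.changeOfVariablesRel) : dimZeroEval c = 0 := by
  have h0 : KZ.eval c = 0 := KZ.eval_eq_zero_of_mem_changeOfVariablesRel_holds hc
  obtain ⟨n, r, r', Φ, Φ', -, -, -, -, -, rfl⟩ := hc
  by_cases hn : n = 0
  · subst hn
    simpa [map_sub] using h0
  · simp [map_sub, hn]

/-- The x-map relators live in dimension `1`: invisible to `dimZeroEval`. -/
theorem dimZeroEval_eq_zero_of_mem_xMapRel {c : KZ.FormalRep} (hc : c ∈ xMapRel) : dimZeroEval c = 0 := by
  obtain ⟨A, B, A', B', f, g, c, a, b, r, r', -, -, -, -, -, -, -, -, -, -, -, rfl⟩ := hc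
  simp [map_sub]

/-- `closure gensWithoutNL ≤ ker dimZeroEval`. -/
theorem closure_gensWithoutNL_le_ker : AddSubgroup.closure gensWithoutNL ≤ dimZeroEval.ker := by
  rw [AddSubgroup.closure_le]
  rintro d (((hd | hd) | hd) | hd)
  · exact dimZeroEval_eq_zero_of_mem_domainAddRel hd
  · exact dimZeroEval_eq_zero_of_mem_integrandAddRel hd
  · exact dimZeroEval_eq_zero_of_mem_changeOfVariablesRel hd
  · exact dimZeroEval_eq_zero_of_mem_xMapRel hd

/-- The honest kernel element `[pt,1]·[0,1] − [pt,1]` (the unit slab: domain `[0,1] ⊆ ℝ¹`,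
integrand `1`, minus the point of mass `1`): ONE Newton–Leibniz move. -/
def slabWitness : KZ.FormalRep := KZ.of (KZ.IntegralRep.unit.slab 0) - KZ.of KZ.IntegralRep.unit

theorem slabWitness_mem_newtonLeibnizRel : slabWitness ∈ KZ.newtonLeibnizRel :=
  KZ.IntegralRep.of_slab_sub_of_mem_newtonLeibnizRel _ 0

theorem eval_slabWitness : KZ.eval slabWitness = 0 :=
  KZ.eval_eq_zero_of_mem_newtonLeibnizRel_holds slabWitness_mem_newtonLeibnizRel

theorem slabWitness_mem_relations : slabWitness ∈ KZ.relations :=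
  KZ.newtonLeibnizRel_subset_relations slabWitness_mem_newtonLeibnizRel

theorem dimZeroEval_slabWitness : dimZeroEval slabWitness = -1 := by
  simp [slabWitness, map_sub]

theorem slabWitness_not_mem_closure_gensWithoutNL : slabWitness ∉ AddSubgroup.closure gensWithoutNL := by
  intro h
  have := closure_gensWithoutNL_le_ker h
  rw [AddMonoidHom.mem_ker, dimZeroEval_slabWitness] at this
  norm_num at this

/-- **F4b. Any proof of the crux must use rule (3) (Newton–Leibniz).** -/
theorem false_without_newtonLeibniz : ¬ WithoutNewtonLeibniz := fun h =>
  slabWitness_not_mem_closure_gensWithoutNL (h _ eval_slabWitness)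

/-- Generators without the additivity rules (1a), (1b): moves (2), (3) and the x-map relators. -/
def gensWithoutAdd : Set KZ.FormalRep := KZ.changeOfVariablesRel ∪ KZ.newtonLeibnizRel ∪ xMapRel

/-- The crux with both additivity moves dropped from the generating set. -/
def WithoutAdditivity : Prop :=
  ∀ c : KZ.FormalRep, KZ.eval c = 0 → c ∈ AddSubgroup.closure gensWithoutAdd

/-- An x-map relator `[r] − [r′]` has coefficient sum `0`. -/
theorem coeffSum_eq_zero_of_mem_xMapRel {c : KZ.FormalRep} (hc : c ∈ xMapRel) : KZ.coeffSum c = 0 := by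
  obtain ⟨A, B, A', B', f, g, c, a, b, r, r', -, -, -, -, -, -, -, -, -, -, -, rfl⟩ := hc
  simp

/-- `closure gensWithoutAdd ≤ ker coeffSum` (tree: `KZ.closure_cov_nl_le_ker_coeffSum` + the above). -/
theorem closure_gensWithoutAdd_le_ker : AddSubgroup.closure gensWithoutAdd ≤ KZ.coeffSum.ker := by
  rw [AddSubgroup.closure_le]
  rintro d ((hd | hd) | hd)
  · exact KZ.coeffSum_eq_zero_of_mem_changeOfVariablesRel hd
  · exact KZ.coeffSum_eq_zero_of_mem_newtonLeibnizRel hd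
  · exact coeffSum_eq_zero_of_mem_xMapRel hd

/-- **F4c. Any proof of the crux must use an additivity move**: the empty representation `[∅]`
(dimension `0`) has value `0` and coefficient sum `1`. -/
theorem false_without_additivity : ¬ WithoutAdditivity := fun h => by
  have h1 := closure_gensWithoutAdd_le_ker (h (KZ.of (KZ.IntegralRep.empty 0)) (by simp))
  rw [AddMonoidHom.mem_ker, KZ.coeffSum_of] at h1
  exact one_ne_zero h1

/-- Dropping the x-map relators instead gives the kernel conjecture VERBATIM (open; = summit). -/
theorem withoutXMapRel_iff :
    (∀ c : KZ.FormalRep, KZ.eval c = 0 → c ∈ AddSubgroup.closure moves) ↔ KZKernelConjecture := Iff.rfl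

/-! ## §4 Refuted natural strengthenings -/

/-- No generating SUBSET that avoids rule (3) generates the kernel … -/
theorem not_ker_le_closure_of_subset_withoutNL {T : Set KZ.FormalRep} (hT : T ⊆ gensWithoutNL) :
    ¬ (∀ c : KZ.FormalRep, KZ.eval c = 0 → c ∈ AddSubgroup.closure T) := fun h =>
  false_without_newtonLeibniz fun c hc => AddSubgroup.closure_mono hT (h c hc)

/-- … nor one that avoids both additivity rules. -/
theorem not_ker_le_closure_of_subset_withoutAdd {T : Set KZ.FormalRep} (hT : T ⊆ gensWithoutAdd) :
    ¬ (∀ c : KZ.FormalRep, KZ.eval c = 0 → c ∈ AddSubgroup.closure T) := fun h =>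
  false_without_additivity fun c hc => AddSubgroup.closure_mono hT (h c hc)

/-- In particular the x-map relators alone do not generate `ker eval` (not even together with
(1a), (1b), (2)). -/
theorem not_ker_le_closure_xMapRel :
    ¬ (∀ c : KZ.FormalRep, KZ.eval c = 0 → c ∈ AddSubgroup.closure xMapRel) :=
  not_ker_le_closure_of_subset_withoutNL subset_union_right

/-! ## §5 Non-vacuity of the fifth generating set (the datum and the rep conditions are jointly satisfiable)

The identity datum `(f, g, c) = (X, 1, 1)` from `y² = x³ + 4x` to itself, with `a = b` and `r = r′`
the honest representation `[{x³+4x>0}, a/√(x³+4x)]` of the sibling file `LemniscateReps`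
(`exists_rep_four`), is an instance of every conjunct: so `0 ∈ xMapRel` and the relator set is not
empty-by-mis-typing. (Every DIAGONAL relator is `0` or a duplicate-generator pair, a relation by one
move — sibling `transfer_diagonal`; a genuinely non-zero relator, e.g. the lemniscate/Landen pair
`(A,B,A′,B′,a,b) = (−1,0,4,0,1,2)`, needs the value identity `∫_{x³−x>0} dx/√(x³−x) =
2∫₀^∞ dX/√(X³+4X)` (substitution `X = x − 1/x` on each sheet `(−1,0)`, `(1,∞)`, both mapped
increasingly onto `(0,∞)`, with `X³+4X = (x²−1)(x²+1)²/x³`; checked on paper, NOT yet in Lean — it is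
the value side of support item LemniscateTwoIsogeny 5382).) -/

/-- The identity datum `(X, 1, 1)` on `y² = x³ + Ax + B` satisfies the Wronskian and the x-map
identity conjuncts. -/
theorem isDatum_identity (A B : ℤ) :
    Polynomial.derivative (Polynomial.X : Polynomial ℚ) * 1 - Polynomial.X * Polynomial.derivative 1 ≠ 0 ∧
    Polynomial.C ((1 : ℚ) ^ 2) * 1 * (Polynomial.X ^ 3 + Polynomial.C (A : ℚ) * Polynomial.X * 1 ^ 2 +
        Polynomial.C (B : ℚ) * 1 ^ 3) =
      (Polynomial.X ^ 3 + Polynomial.C (A : ℚ) * Polynomial.X + Polynomial.C (B : ℚ)) *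
        (Polynomial.derivative (Polynomial.X : Polynomial ℚ) * 1 - Polynomial.X * Polynomial.derivative 1) ^ 2 := by
  constructor
  · simp
  · simp

/-- **`0 ∈ xMapRel`**: the relator set is non-empty as typed (curve `y² = x³ + 4x`, identity datum,
`a = b = 1`, `r = r′ = [{x³+4x>0}, 1/√(x³+4x)]`). -/
theorem zero_mem_xMapRel : (0 : KZ.FormalRep) ∈ xMapRel := by
  obtain ⟨r, hd, hi⟩ :=
    Summit.KontsevichZagierPeriods.IsogenyCertificates.XMapPeriodTransferValue.exists_rep_four 1
  obtain ⟨hW, hI⟩ := isDatum_identity 4 0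
  refine ⟨4, 0, 4, 0, Polynomial.X, 1, 1, 1, 1, r, r, by norm_num, by norm_num, hW, hI, one_pos, one_pos,
    hd, ?_, hd, ?_, rfl, (sub_self _).symm⟩
  · rw [hi]; exact fun x _ => rfl
  · rw [hi]; exact fun x _ => rfl

/-- Hence the relator set is non-empty. -/
theorem xMapRel_nonempty : xMapRel.Nonempty := ⟨0, zero_mem_xMapRel⟩

/-! ## §6 The remaining single-rule drops: (1a) needed ON PAPER (near-miss), (1b) and (2) open

Status of "is rule R load-bearing for the crux?" after this cycle:
* (3) Newton–Leibniz: YES, at every level (§3 `false_without_newtonLeibniz`, landed; F7 levelwise,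
  p98622 ACCEPTED).
* (1a)+(1b) together: YES (§3 `false_without_additivity`, `KZ.coeffSum`).
* (1a) alone: YES, modulo van den Dries Ch. 4 (2.4) — PROVED (F8 below): folder files
  `EulerWeightedEval.lean` (p100323 → `Negative/EulerWeightedEval.lean`, on top of the landed
  `CompleteModGammaSector/Negative/EulerGlue.lean`), `DomainAdditivity.lean`,
  `CubicRealLocus.lean` (p99637 ACCEPTED → `Negative/CubicRealLocus.lean`), `CubicLocusEuler.lean`
  (`false_without_domainAdd_of_vdD : hE → ¬ WithoutDomainAdd` verbatim for the def below).
* (1b) alone, (2) alone: OPEN — no additive invariant is known that kills the other three rules and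
  the x-map relators without being a multiple of `eval` (by vdD Ch. 4 (2.14) any rule-2-invariant
  function of the DOMAIN factors through `(dim, E)`, and every `E`-weighted evaluation
  `g(E(σ))·∫_σ f` IS killed by (1b); weighted Lebesgue integrals `∫_σ f·w` are forced to `w = const`
  by the rule-3 chain down to dimension `0`; singular measures break (1a) or integrability).
* x-map relators: dropping them gives `KZKernelConjecture` verbatim (open, = summit). -/

/-- Generators without rule (1a): moves (1b), (2), (3) and the x-map relators. -/
def gensWithoutDomainAdd : Set KZ.FormalRep :=
  KZ.integrandAddRel ∪ KZ.changeOfVariablesRel ∪ KZ.newtonLeibnizRel ∪ xMapRel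

/-- The crux with domain additivity dropped from the generating set. -/
def WithoutDomainAdd : Prop :=
  ∀ c : KZ.FormalRep, KZ.eval c = 0 → c ∈ AddSubgroup.closure gensWithoutDomainAdd

/-- The crux with integrand additivity dropped (STATUS: open — no invariant known). -/
def WithoutIntegrandAdd : Prop :=
  ∀ c : KZ.FormalRep, KZ.eval c = 0 →
    c ∈ AddSubgroup.closure (KZ.domainAddRel ∪ KZ.changeOfVariablesRel ∪ KZ.newtonLeibnizRel ∪ xMapRel)

/-- The crux with change of variables dropped (STATUS: open — no invariant known; note that in
dimension `1` a rule-2 move `[I, f] − [Φ I, f′]` with a SEMIALGEBRAIC primitive available factors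
through dimension `0` by two rule-3 moves, so a witness must involve integrands without
semialgebraic primitive, e.g. `1/√(x³ − x)` and a translate — cf. the barrier
`Literature.Barriers.KontsevichZagierPeriods.noSemialgebraicPrimitive_inv_sub_two`). -/
def WithoutChangeOfVariables : Prop :=
  ∀ c : KZ.FormalRep, KZ.eval c = 0 →
    c ∈ AddSubgroup.closure (KZ.domainAddRel ∪ KZ.integrandAddRel ∪ KZ.newtonLeibnizRel ∪ xMapRel)

/-! **F8 — rule (1a) is load-bearing, modulo van den Dries Ch. 4 (2.4): PROVED** (cycle 2; no
`sorry` anywhere). The proof lives in the landing files of the Negative lane (folder copies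
`EulerWeightedEval.lean` = p100323 (revision of p99149, reusing the landed
`CompleteModGammaSector/Negative/EulerGlue.lean`), `DomainAdditivity.lean`, `CubicRealLocus.lean` = p99637 ACCEPTED,
`CubicLocusEuler.lean`; the whole chain checks rc 0 as the single scratch file `PartBCheck.lean`,
attached as item evidence), not in this work file, because it needs modules that are not yet built
on the farm. STATEMENT (namespace `Summit.KontsevichZagierPeriods.XMapKernel.Negative`):
`false_without_domainAdd_of_vdD : Dries1998_ch4_prop_2_4 Language.orderedRing ℝ →
 ¬ (∀ c, KZ.eval c = 0 → c ∈ closure (integrandAddRel ∪ changeOfVariablesRel ∪ newtonLeibnizRel ∪ xMapRel))`,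
i.e. `hE → ¬ WithoutDomainAdd` for the `WithoutDomainAdd` above. PROOF. Euler-weighted evaluation
`J [σ, f] := 𝟙[E(σ) = 0] · ∫_σ f` (`E` = o-minimal Euler characteristic, tree `eulerChar` over the
ordered field `ℝ`): (1b) keeps the domain and is sound; (2) maps `σ` to a definably-bijective image
(`E` invariant by the FACT (2.4)) and is sound; (3) replaces a band with closed bounded fibres by its
base (`E` invariant by the fibre formula `eulerChar_eq_eulerChar_proj_mul`, unconditionally) and is
sound; an x-map relator has both domains `{x³+Ax+B > 0}` = a ray or an interval plus a ray
(`cubicLocus_cases_int`: IVT at `±∞`, factorisation `t³+at+b = (t−u)(t−v)(t+u+v)` through two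
distinct roots, discriminant identity against a double root), so `E ∈ {−1, −2}` and both weights
vanish — NO value identity needed. Witness: the (1a) instance `[(0,2),1] − [(0,1],1] − [(1,2),1]`
(`E = −1, 0, −1`, values `2, 1, 1`): `J = −1 ≠ 0`, `eval = 0`. ∎ Unconditional corollary
(`kernel_false_without_domainAdd_and_cov`): rules (1b) + (3) alone do not generate `ker eval`. -/

end Summit.KontsevichZagierPeriods.KontsevichZagierPeriods.Cruxes.XMapKernel.Disproof
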